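import Summits.QuantumFields.YangMills.Theorems.UnitScaleTiltProp7LandauTransversalityPairing
import HarnessLib

/-!
# Route `UnitScaleTilt`, crux K1 child «MinimiserStabilityRegPr» (stmt-QuantumFields-19200), skeleton v10, stub `stub_existenceMinimalOrbit` (EX), route (α) —
# **THE (P2-core) PAIRING TEST FROM THE SIX DISPLAYED ROWS OF PLAN v2** (R2b″ of the (P2-core) plan v2, LOCATE memo `pub/ym3-torus/ym-ust-20520-w5/g7/LOCATE-P2-MARGIN-w5g7.md`
# §2 (M), §5): the two supplier rows (hP), (hS) of ✓`Prop7LandauTransversalityPairing.htest_of_suppliers` are THEMSELVES assembled here from the rows the plan-v2 files deliver —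
# a Poincaré inequality on the «zero nested mean» sector `Z` (R2a ✓p656268 ∕ ✓p656969 ∕ ✓p657637 + ROW-B + ROW-T), the sector decomposition (H-Z), the EXACT `H²`-smooth right inverse of
# the frame-corrected gauge operator `𝓚` (R2q″), the transfer smallness of `𝓚` on `Z` (R2t + ✓p660090 R2t′), the differentiated gauge covariance of the average (`𝓚 N′ = 0 ⟹ T(M⁻¹Gd N′) = 0`,
# T5-A), and the rotated-direction divergence bound (✓p660993 `Prop7GaugeDirRotationDivergence.norm_DstarL2_transfer_le`) — every row in the currencies `‖toL2S ·‖, ‖DL2 U₀ (toL2S ·)‖,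
# ‖covLapSite U₀ (toL2S ·)‖` of the member's weighted `L²` spaces, the coarse side through an ARBITRARY size functional `q` on an arbitrary additive group `Y` (so the R2t ∕ R2q″ hands fix
# their common coarse currency between themselves and this file composes with both by `exact`).

Cell `ym3-torus`, width seat `ym-ust-20520-w5` (gen 7).  THEOREMS ONLY (0 `def`, 0 `sorry`).  `--supports stmt-QuantumFields-19200 --as helper`, count-neutral.  YM₃ on T³ is a
ladder rung (R3), not the Clay problem; nothing here claims the stub, the crux, d = 4 or the mass gap.

WHAT IS PROVED (sorry-free, no definition; ns `…Theorems.Prop7LandauTransversalityPairing`):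
* §0 `norm_DL2_sq_le` — `‖D_{U₀}v‖² ≤ ‖v‖·‖Δ^η_{U₀}v‖` (✓`inner_covLapSite`); `norms_le_of_poincareSq` — `‖v‖² ≤ P₂‖D_{U₀}v‖²`, `1 ≤ P₂` ⟹ `‖D_{U₀}v‖ ≤ P₂‖Δ^η v‖ ∧ ‖v‖ ≤ P₂‖Δ^η v‖`.
* §1 ★★`htest_of_suppliersZ` — ✓`htest_of_suppliers` with an arbitrary SECTOR PREDICATE `Z` threaded: (hP) may deliver `Z l₁`, (hS) may assume it.
* §2 ★★`hP_of_poincareZ` — (hP) (with `Z l₁`, `C := P₂`) from the squared Poincaré row on `N_S ∩ Z` and the sector row (H-Z) «every residual has a `Z`-representative in `N_S` with the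
  same `D_{U₀}`-image».
* §3 ★★★`hS_of_rowsZ` — (hS) on `N_S ∩ Z` (with `θ := C₀·δ·(2P₂)`) from: `M b` onto, the T-row «`M w = Gd N′ ∧ 𝓚 N′ = 0 ⟹ T w = 0`», the divergence row «`M w = Gd N′ ⟹ ‖D*(toL2 w +
  η·D(toL2S N′))‖ ≤ η·a′·(‖toL2S N′‖ + ‖D(toL2S N′)‖)`», the exact right inverse (Q4-H²) «`∀ m, ∃ N, 𝓚 N = m`, `‖toL2S N‖, ‖D(toL2S N)‖, ‖Δ^η(toL2S N)‖ ≤ C₀·q m`», the transfer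
  row (T) «`q (𝓚 l₁) ≤ δ·(‖toL2S l₁‖ + ‖D(toL2S l₁)‖)` on `N_S ∩ Z`» and the Poincaré row: `N′ := l₁ − N(𝓚 l₁)`.
* §4 ★★★`htest_of_rows` — the pairing test of ✓`Prop7LandauTransversalityMargin.hcore_of_pairing` from the six rows under the L-only window `2a′(P₂ + θ) + θ < 1`.
HONEST SCOPE.  Linear-algebra bookkeeping over the member's Hilbert letters; every analytic input is a displayed HYPOTHESIS whose supplier is a named plan-v2 file (open or landed);
nothing of print asserted; no stub ∕ crux statement advanced.

References: T. Bałaban, CMP 99 (1985) 389–434 [Balaban1985BackgroundPropagators] ((3.3) p.391, (3.8) p.392, (3.20)–(3.23) p.394, (3.115) p.418); CMP 102 (1985) 277–309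
[Balaban1985Variational] ((45) p.285, (82)–(83) p.290).
-/

set_option autoImplicit false

noncomputable section

open scoped InnerProductSpace Matrix.Norms.L2Operator ComplexConjugate

namespace Summit.QuantumFields.YangMills.Theorems.Prop7LandauTransversalityPairing

open Literature.MathematicalPhysics.QuantumFieldTheory.Balaban1983to89
open Literature.MathematicalPhysics.QuantumFieldTheory.Balaban1983to89.T3ContinuumYM3Torus
open Literature.MathematicalPhysics.QuantumFieldTheory.Balaban1983to89.T3SectALandauChart (eta eta_pos)
open B11Eq103H1Complex (SiteL2K BondL2K)
open Summit.QuantumFields.YangMills.Theorems.Prop7SectET3Transport (periodsT3)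
open Summit.QuantumFields.YangMills.Theorems.Prop7SymAvgTwSym (QTwS)
open Summit.QuantumFields.YangMills.Theorems.Prop7SectET3HilbertLetters (W₂ toL2 toL2S DL2 DstarL2 covLapSite adjoint_DL2 inner_covLapSite)
open Summit.QuantumFields.YangMills.Theorems.Prop7SectET3GaugeProjector (NS)

variable (F : T3Family) {n K : ℕ} {c₀ : ℝ} [Fact (0 < c₀)]

/-! ## §0 `‖Dv‖² ≤ ‖v‖‖Δv‖` and the two norms from a squared Poincaré inequality -/

/-- **`‖D_{U₀}v‖² ≤ ‖v‖·‖Δ^η_{U₀}v‖`** (`⟨v, Δ^η v⟩ = ‖Dv‖²`, Cauchy–Schwarz). [cite: Balaban1985BackgroundPropagators, (3.23) p.394] -/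
theorem norm_DL2_sq_le (U₀ : GaugeField (F.P K) 0 (Matrix.specialUnitaryGroup (Fin 2) ℂ)) (v : SiteL2K ℂ 3 (periodsT3 F K) c₀ W₂) :
    ‖DL2 F n K c₀ U₀ v‖ ^ 2 ≤ ‖v‖ * ‖covLapSite F n K c₀ U₀ v‖ := by
  have h1 : ((‖DL2 F n K c₀ U₀ v‖ ^ 2 : ℝ) : ℂ) = ⟪v, covLapSite F n K c₀ U₀ v⟫_ℂ := by
    rw [inner_covLapSite, Complex.ofReal_pow]
  have h2 : ‖DL2 F n K c₀ U₀ v‖ ^ 2 = ‖⟪v, covLapSite F n K c₀ U₀ v⟫_ℂ‖ := by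
    rw [← h1, Complex.norm_real, Real.norm_of_nonneg (sq_nonneg _)]
  rw [h2]
  exact norm_inner_le_norm _ _

/-- **THE TWO NORMS FROM A SQUARED POINCARÉ INEQUALITY**: `‖v‖² ≤ P₂·‖D_{U₀}v‖²` with `1 ≤ P₂` gives `‖D_{U₀}v‖ ≤ P₂·‖Δ^η_{U₀}v‖` and `‖v‖ ≤ P₂·‖Δ^η_{U₀}v‖` (through `‖Dv‖² ≤ ‖v‖‖Δv‖`;
`√P₂ ≤ P₂`). [cite: Balaban1985BackgroundPropagators, (3.23) p.394, (3.115) p.418] -/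
theorem norms_le_of_poincareSq (U₀ : GaugeField (F.P K) 0 (Matrix.specialUnitaryGroup (Fin 2) ℂ)) {P₂ : ℝ} (h1 : 1 ≤ P₂) (v : SiteL2K ℂ 3 (periodsT3 F K) c₀ W₂)
    (hP : ‖v‖ ^ 2 ≤ P₂ * ‖DL2 F n K c₀ U₀ v‖ ^ 2) :
    ‖DL2 F n K c₀ U₀ v‖ ≤ P₂ * ‖covLapSite F n K c₀ U₀ v‖ ∧ ‖v‖ ≤ P₂ * ‖covLapSite F n K c₀ U₀ v‖ := by
  set a : ℝ := ‖v‖ with ha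
  set d : ℝ := ‖DL2 F n K c₀ U₀ v‖ with hd
  set m : ℝ := ‖covLapSite F n K c₀ U₀ v‖ with hm
  have ha0 : 0 ≤ a := norm_nonneg _
  have hd0 : 0 ≤ d := norm_nonneg _
  have hm0 : 0 ≤ m := norm_nonneg _
  have hP0 : 0 ≤ P₂ := zero_le_one.trans h1
  have hdam : d ^ 2 ≤ a * m := norm_DL2_sq_le F U₀ v
  -- `s := √P₂`, `1 ≤ s ≤ P₂`, `a ≤ s·d`
  set s : ℝ := Real.sqrt P₂ with hs
  have hs0 : 0 ≤ s := Real.sqrt_nonneg _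
  have hss : s * s = P₂ := Real.mul_self_sqrt hP0
  have hs1 : 1 ≤ s := by rw [hs, ← Real.sqrt_one]; exact Real.sqrt_le_sqrt h1
  have hsP : s ≤ P₂ := by nlinarith
  have has : a ≤ s * d := by
    have h3 : a ^ 2 ≤ (s * d) ^ 2 := by rw [mul_pow, sq s, hss]; exact hP
    have h4 := Real.sqrt_le_sqrt h3
    rwa [Real.sqrt_sq ha0, Real.sqrt_sq (mul_nonneg hs0 hd0)] at h4
  -- `d ≤ s·m`
  have hdsm : d ≤ s * m := by
    rcases hd0.eq_or_lt with hd00 | hdpos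
    · rw [← hd00]; exact mul_nonneg hs0 hm0
    · have h5 : d * d ≤ s * m * d := by
        calc d * d = d ^ 2 := (sq d).symm
          _ ≤ a * m := hdam
          _ ≤ s * d * m := mul_le_mul_of_nonneg_right has hm0
          _ = s * m * d := by ring
      exact le_of_mul_le_mul_right h5 hdpos
  refine ⟨hdsm.trans (mul_le_mul_of_nonneg_right hsP hm0), ?_⟩
  calc a ≤ s * d := has
    _ ≤ s * (s * m) := mul_le_mul_of_nonneg_left hdsm hs0
    _ = P₂ * m := by rw [← mul_assoc, hss]

/-! ## §1 The supplier socket with a sector predicate threaded -/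

/-- ★★ **✓`htest_of_suppliers` WITH A SECTOR PREDICATE `Z` THREADED** (the «zero nested mean» sector of plan v2, kept abstract): (hP) delivers a representative `l₁ ∈ N_S(U₀)` WITH `Z l₁`,
(hS) is only asked on `N_S ∩ Z`; same window `2a′(C + θ) + θ < 1`, same conclusion (the pairing test of ✓`hcore_of_pairing`, `κ := −η`).
[cite: Balaban1985BackgroundPropagators, (3.3) p.391, (3.8) p.392, (3.20)–(3.23) p.394; Balaban1985Variational, (45) p.285] -/
theorem htest_of_suppliersZ {h : n ≤ K} {cB : ℝ} (U₀ : GaugeField (F.P K) 0 (Matrix.specialUnitaryGroup (Fin 2) ℂ))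
    (Z : (Site (F.P K) 0 → Matrix (Fin 2) (Fin 2) ℂ) → Prop)
    {T : (PBond (F.P K) 0 → Matrix (Fin 2) (Fin 2) ℂ) →L[ℂ] (PBond (F.P n) 0 → Matrix (Fin 2) (Fin 2) ℂ)}
    (M : PBond (F.P K) 0 → (Matrix (Fin 2) (Fin 2) ℂ →L[ℂ] Matrix (Fin 2) (Fin 2) ℂ))
    (Gd : (Site (F.P K) 0 → Matrix (Fin 2) (Fin 2) ℂ) →ₗ[ℂ] (PBond (F.P K) 0 → Matrix (Fin 2) (Fin 2) ℂ))
    {C a' θ : ℝ} (ha' : 0 ≤ a') (hwin : 2 * a' * (C + θ) + θ < 1)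
    (hP : ∀ l : Site (F.P K) 0 → Matrix (Fin 2) (Fin 2) ℂ, toL2S F K c₀ l ∈ NS F n K h c₀ cB U₀ →
      ∃ l₁ : Site (F.P K) 0 → Matrix (Fin 2) (Fin 2) ℂ, toL2S F K c₀ l₁ ∈ NS F n K h c₀ cB U₀ ∧ Z l₁ ∧
        covLapSite F n K c₀ U₀ (toL2S F K c₀ l₁) = covLapSite F n K c₀ U₀ (toL2S F K c₀ l) ∧
        ‖toL2S F K c₀ l₁‖ ≤ C * ‖covLapSite F n K c₀ U₀ (toL2S F K c₀ l)‖ ∧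
        ‖DL2 F n K c₀ U₀ (toL2S F K c₀ l₁)‖ ≤ C * ‖covLapSite F n K c₀ U₀ (toL2S F K c₀ l)‖)
    (hS : ∀ l₁ : Site (F.P K) 0 → Matrix (Fin 2) (Fin 2) ℂ, toL2S F K c₀ l₁ ∈ NS F n K h c₀ cB U₀ → Z l₁ →
      ∃ (N' : Site (F.P K) 0 → Matrix (Fin 2) (Fin 2) ℂ) (w : PBond (F.P K) 0 → Matrix (Fin 2) (Fin 2) ℂ),
        (∀ b, M b (w b) = Gd N' b) ∧ T w = 0 ∧
        ‖DstarL2 F n K c₀ U₀ (toL2 F K c₀ w + ((eta F n K : ℝ) : ℂ) • DL2 F n K c₀ U₀ (toL2S F K c₀ N'))‖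
          ≤ eta F n K * a' * (‖toL2S F K c₀ N'‖ + ‖DL2 F n K c₀ U₀ (toL2S F K c₀ N')‖) ∧
        ‖covLapSite F n K c₀ U₀ (toL2S F K c₀ N' - toL2S F K c₀ l₁)‖ ≤ θ * ‖covLapSite F n K c₀ U₀ (toL2S F K c₀ l₁)‖ ∧
        ‖toL2S F K c₀ N' - toL2S F K c₀ l₁‖ ≤ θ * ‖covLapSite F n K c₀ U₀ (toL2S F K c₀ l₁)‖ ∧
        ‖DL2 F n K c₀ U₀ (toL2S F K c₀ N' - toL2S F K c₀ l₁)‖ ≤ θ * ‖covLapSite F n K c₀ U₀ (toL2S F K c₀ l₁)‖) :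
    ∀ l : Site (F.P K) 0 → Matrix (Fin 2) (Fin 2) ℂ, toL2S F K c₀ l ∈ NS F n K h c₀ cB U₀ →
      covLapSite F n K c₀ U₀ (toL2S F K c₀ l) ≠ 0 →
      ∃ (N' : Site (F.P K) 0 → Matrix (Fin 2) (Fin 2) ℂ) (w : PBond (F.P K) 0 → Matrix (Fin 2) (Fin 2) ℂ),
        (∀ b, M b (w b) = Gd N' b) ∧ T w = 0 ∧ ⟪toL2 F K c₀ w, DL2 F n K c₀ U₀ (covLapSite F n K c₀ U₀ (toL2S F K c₀ l))⟫_ℂ ≠ 0 := by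
  have hη : 0 < eta F n K := eta_pos F n K
  intro l hl hΔ
  obtain ⟨l₁, hl₁, hZ₁, hΔeq, hl₁0, hl₁1⟩ := hP l hl
  obtain ⟨N', w, hMw, hTw, hrot, hH2, hH0, hH1⟩ := hS l₁ hl₁ hZ₁
  refine ⟨N', w, hMw, hTw, ?_⟩
  rw [← hΔeq]
  refine pairing_ne_zero_of_norm_lt F U₀ _ _ (κ := -(((eta F n K : ℝ) : ℂ))) ?_
  set r : ℝ := ‖covLapSite F n K c₀ U₀ (toL2S F K c₀ l₁)‖ with hr
  have hr0 : 0 < r := by rw [hr, hΔeq]; exact norm_pos_iff.2 hΔ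
  rw [← hΔeq, ← hr] at hl₁0 hl₁1
  have hκ : ‖-(((eta F n K : ℝ) : ℂ))‖ = eta F n K := by rw [norm_neg, Complex.norm_real, Real.norm_of_nonneg hη.le]
  rw [hκ]
  have hsplit : toL2 F K c₀ w - (-(((eta F n K : ℝ) : ℂ))) • DL2 F n K c₀ U₀ (toL2S F K c₀ l₁)
      = (toL2 F K c₀ w + ((eta F n K : ℝ) : ℂ) • DL2 F n K c₀ U₀ (toL2S F K c₀ N')) - ((eta F n K : ℝ) : ℂ) • DL2 F n K c₀ U₀ (toL2S F K c₀ N' - toL2S F K c₀ l₁) := by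
    rw [map_sub, smul_sub, neg_smul, sub_neg_eq_add]; abel
  have hΔN : DstarL2 F n K c₀ U₀ (DL2 F n K c₀ U₀ (toL2S F K c₀ N' - toL2S F K c₀ l₁)) = covLapSite F n K c₀ U₀ (toL2S F K c₀ N' - toL2S F K c₀ l₁) := rfl
  have hN0 : ‖toL2S F K c₀ N'‖ ≤ (C + θ) * r := by
    calc ‖toL2S F K c₀ N'‖ = ‖toL2S F K c₀ l₁ + (toL2S F K c₀ N' - toL2S F K c₀ l₁)‖ := by rw [add_sub_cancel]
      _ ≤ ‖toL2S F K c₀ l₁‖ + ‖toL2S F K c₀ N' - toL2S F K c₀ l₁‖ := norm_add_le _ _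
      _ ≤ C * r + θ * r := add_le_add hl₁0 hH0
      _ = (C + θ) * r := by ring
  have hN1 : ‖DL2 F n K c₀ U₀ (toL2S F K c₀ N')‖ ≤ (C + θ) * r := by
    calc ‖DL2 F n K c₀ U₀ (toL2S F K c₀ N')‖ = ‖DL2 F n K c₀ U₀ (toL2S F K c₀ l₁) + DL2 F n K c₀ U₀ (toL2S F K c₀ N' - toL2S F K c₀ l₁)‖ := by
          rw [← map_add, add_sub_cancel]
      _ ≤ ‖DL2 F n K c₀ U₀ (toL2S F K c₀ l₁)‖ + ‖DL2 F n K c₀ U₀ (toL2S F K c₀ N' - toL2S F K c₀ l₁)‖ := norm_add_le _ _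
      _ ≤ C * r + θ * r := add_le_add hl₁1 hH1
      _ = (C + θ) * r := by ring
  calc ‖DstarL2 F n K c₀ U₀ (toL2 F K c₀ w - (-(((eta F n K : ℝ) : ℂ))) • DL2 F n K c₀ U₀ (toL2S F K c₀ l₁))‖
      = ‖DstarL2 F n K c₀ U₀ (toL2 F K c₀ w + ((eta F n K : ℝ) : ℂ) • DL2 F n K c₀ U₀ (toL2S F K c₀ N'))
          - ((eta F n K : ℝ) : ℂ) • covLapSite F n K c₀ U₀ (toL2S F K c₀ N' - toL2S F K c₀ l₁)‖ := by rw [hsplit, map_sub, map_smul, hΔN]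
    _ ≤ ‖DstarL2 F n K c₀ U₀ (toL2 F K c₀ w + ((eta F n K : ℝ) : ℂ) • DL2 F n K c₀ U₀ (toL2S F K c₀ N'))‖
          + ‖((eta F n K : ℝ) : ℂ) • covLapSite F n K c₀ U₀ (toL2S F K c₀ N' - toL2S F K c₀ l₁)‖ := norm_sub_le _ _
    _ ≤ eta F n K * a' * (‖toL2S F K c₀ N'‖ + ‖DL2 F n K c₀ U₀ (toL2S F K c₀ N')‖) + eta F n K * (θ * r) := by
          refine add_le_add hrot ?_
          rw [norm_smul, Complex.norm_real, Real.norm_of_nonneg hη.le]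
          exact mul_le_mul_of_nonneg_left hH2 hη.le
    _ ≤ eta F n K * a' * ((C + θ) * r + (C + θ) * r) + eta F n K * (θ * r) := by gcongr
    _ = eta F n K * ((2 * a' * (C + θ) + θ) * r) := by ring
    _ < eta F n K * (1 * r) := by
          refine mul_lt_mul_of_pos_left ?_ hη
          exact mul_lt_mul_of_pos_right hwin hr0
    _ = eta F n K * ‖covLapSite F n K c₀ U₀ (toL2S F K c₀ l₁)‖ := by rw [one_mul, hr]

/-! ## §2 (hP) from the Poincaré row on `N_S ∩ Z` and the sector row (H-Z) -/

/-- ★★ **THE POINCARÉ REPRESENTATIVE ROW (hP) FROM TWO DISPLAYED ROWS.**  IF (Poincaré on the sector) every `l₁` with `toL2S l₁ ∈ N_S(U₀)` and `Z l₁` has `‖toL2S l₁‖² ≤ P₂·‖D_{U₀}(toL2S l₁)‖²`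
(`1 ≤ P₂`; R2a ✓`Prop7NestedMeanPoincare` ∕ ROW-B ∕ ROW-T with `Z` = «zero top nested mean», `P₂ = 2`), and (H-Z) every residual `l` has some `l₁` with `toL2S l₁ ∈ N_S(U₀)`, `Z l₁` and THE SAME
`D_{U₀}`-image, THEN (hP) of ✓`htest_of_suppliersZ` holds with `C := P₂` (same `Δ^η = D*D`; `‖Dl₁‖, ‖l₁‖ ≤ P₂‖Δ^η l₁‖` by ✓`norms_le_of_poincareSq`).
[cite: Balaban1985BackgroundPropagators, (3.23) p.394, (3.115) p.418] -/
theorem hP_of_poincareZ {h : n ≤ K} {cB : ℝ} (U₀ : GaugeField (F.P K) 0 (Matrix.specialUnitaryGroup (Fin 2) ℂ))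
    (Z : (Site (F.P K) 0 → Matrix (Fin 2) (Fin 2) ℂ) → Prop) {P₂ : ℝ} (h1 : 1 ≤ P₂)
    (hPoinc : ∀ l₁ : Site (F.P K) 0 → Matrix (Fin 2) (Fin 2) ℂ, toL2S F K c₀ l₁ ∈ NS F n K h c₀ cB U₀ → Z l₁ →
      ‖toL2S F K c₀ l₁‖ ^ 2 ≤ P₂ * ‖DL2 F n K c₀ U₀ (toL2S F K c₀ l₁)‖ ^ 2)
    (hHZ : ∀ l : Site (F.P K) 0 → Matrix (Fin 2) (Fin 2) ℂ, toL2S F K c₀ l ∈ NS F n K h c₀ cB U₀ →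
      ∃ l₁ : Site (F.P K) 0 → Matrix (Fin 2) (Fin 2) ℂ, toL2S F K c₀ l₁ ∈ NS F n K h c₀ cB U₀ ∧ Z l₁ ∧
        DL2 F n K c₀ U₀ (toL2S F K c₀ l₁) = DL2 F n K c₀ U₀ (toL2S F K c₀ l)) :
    ∀ l : Site (F.P K) 0 → Matrix (Fin 2) (Fin 2) ℂ, toL2S F K c₀ l ∈ NS F n K h c₀ cB U₀ →
      ∃ l₁ : Site (F.P K) 0 → Matrix (Fin 2) (Fin 2) ℂ, toL2S F K c₀ l₁ ∈ NS F n K h c₀ cB U₀ ∧ Z l₁ ∧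
        covLapSite F n K c₀ U₀ (toL2S F K c₀ l₁) = covLapSite F n K c₀ U₀ (toL2S F K c₀ l) ∧
        ‖toL2S F K c₀ l₁‖ ≤ P₂ * ‖covLapSite F n K c₀ U₀ (toL2S F K c₀ l)‖ ∧
        ‖DL2 F n K c₀ U₀ (toL2S F K c₀ l₁)‖ ≤ P₂ * ‖covLapSite F n K c₀ U₀ (toL2S F K c₀ l)‖ := by
  intro l hl
  obtain ⟨l₁, hl₁, hZ₁, hDeq⟩ := hHZ l hl
  have hΔeq : covLapSite F n K c₀ U₀ (toL2S F K c₀ l₁) = covLapSite F n K c₀ U₀ (toL2S F K c₀ l) := by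
    show DstarL2 F n K c₀ U₀ (DL2 F n K c₀ U₀ (toL2S F K c₀ l₁)) = DstarL2 F n K c₀ U₀ (DL2 F n K c₀ U₀ (toL2S F K c₀ l))
    rw [hDeq]
  obtain ⟨hD, h0⟩ := norms_le_of_poincareSq F U₀ h1 (toL2S F K c₀ l₁) (hPoinc l₁ hl₁ hZ₁)
  rw [hΔeq] at hD h0
  exact ⟨l₁, hl₁, hZ₁, hΔeq, h0, hD⟩

/-! ## §3 (hS) from the transfer rows -/

/-- ★★★ **THE TRANSFER ROW (hS) ON THE SECTOR `N_S ∩ Z` FROM THE DISPLAYED ROWS OF PLAN v2.**  Data: the member's `T, M, Gd` (✓`hcore_of_pairing`), a «frame-corrected gauge operator» `𝓚`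
into ANY additive group `Y` (T5-A ✓`Prop7FrameLevelOnto.exists_frameCorrected_eq`'s `N ↦ (x ↦ N(x̂⁽ᵏ⁾) − V x·ν_k(x)⁻¹)`, kept abstract; only `𝓚(a − b) = 𝓚 a − 𝓚 b` is used) with a size functional `q`.
ROWS: (M) every `M b` is onto; (T) «`M w = Gd N′` bondwise and `𝓚 N′ = 0` ⟹ `T w = 0`» (the differentiated gauge covariance of the average); (D*) «`M w = Gd N′` ⟹ `‖D*_{U₀}(toL2 w +
η·D_{U₀}(toL2S N′))‖ ≤ η·a′·(‖toL2S N′‖ + ‖D_{U₀}(toL2S N′)‖)`» (✓`Prop7GaugeDirRotationDivergence.norm_DstarL2_transfer_le` at the chart); (Q4-H²) EXACT right inverse «`∀ m, ∃ N, 𝓚 N = m`,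
`‖toL2S N‖, ‖D_{U₀}(toL2S N)‖, ‖Δ^η_{U₀}(toL2S N)‖ ≤ C₀·q m`» (R2q″); (T-small) «`q(𝓚 l₁) ≤ δ·(‖toL2S l₁‖ + ‖D_{U₀}(toL2S l₁)‖)` on `N_S ∩ Z`» (R2t + ✓p660090 R2t′); (Poincaré) as in
✓`hP_of_poincareZ`.  THEN (hS) of ✓`htest_of_suppliersZ` holds on `N_S ∩ Z` with `θ := C₀·δ·(2P₂)`: take `N′ := l₁ − N(𝓚 l₁)`, `w := M⁻¹(Gd N′)`.
[cite: Balaban1985BackgroundPropagators, (3.20)–(3.23) p.394, (3.115) p.418; Balaban1985Variational, (45) p.285, (82)–(83) p.290] -/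
theorem hS_of_rowsZ {h : n ≤ K} {cB : ℝ} (U₀ : GaugeField (F.P K) 0 (Matrix.specialUnitaryGroup (Fin 2) ℂ))
    (Z : (Site (F.P K) 0 → Matrix (Fin 2) (Fin 2) ℂ) → Prop)
    {T : (PBond (F.P K) 0 → Matrix (Fin 2) (Fin 2) ℂ) →L[ℂ] (PBond (F.P n) 0 → Matrix (Fin 2) (Fin 2) ℂ)}
    (M : PBond (F.P K) 0 → (Matrix (Fin 2) (Fin 2) ℂ →L[ℂ] Matrix (Fin 2) (Fin 2) ℂ)) (hMs : ∀ b, Function.Surjective (M b))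
    (Gd : (Site (F.P K) 0 → Matrix (Fin 2) (Fin 2) ℂ) →ₗ[ℂ] (PBond (F.P K) 0 → Matrix (Fin 2) (Fin 2) ℂ))
    {Y : Type*} [AddCommGroup Y] (Kop : (Site (F.P K) 0 → Matrix (Fin 2) (Fin 2) ℂ) → Y) (q : Y → ℝ)
    (hKsub : ∀ a b : Site (F.P K) 0 → Matrix (Fin 2) (Fin 2) ℂ, Kop (a - b) = Kop a - Kop b)
    (hT : ∀ (N' : Site (F.P K) 0 → Matrix (Fin 2) (Fin 2) ℂ) (w : PBond (F.P K) 0 → Matrix (Fin 2) (Fin 2) ℂ),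
      (∀ b, M b (w b) = Gd N' b) → Kop N' = 0 → T w = 0)
    {a' C₀ δ P₂ : ℝ} (hC₀ : 0 ≤ C₀) (hδ : 0 ≤ δ) (h1 : 1 ≤ P₂)
    (hDstar : ∀ (N' : Site (F.P K) 0 → Matrix (Fin 2) (Fin 2) ℂ) (w : PBond (F.P K) 0 → Matrix (Fin 2) (Fin 2) ℂ), (∀ b, M b (w b) = Gd N' b) →
      ‖DstarL2 F n K c₀ U₀ (toL2 F K c₀ w + ((eta F n K : ℝ) : ℂ) • DL2 F n K c₀ U₀ (toL2S F K c₀ N'))‖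
        ≤ eta F n K * a' * (‖toL2S F K c₀ N'‖ + ‖DL2 F n K c₀ U₀ (toL2S F K c₀ N')‖))
    (hQ4 : ∀ m : Y, ∃ N : Site (F.P K) 0 → Matrix (Fin 2) (Fin 2) ℂ, Kop N = m ∧ ‖toL2S F K c₀ N‖ ≤ C₀ * q m ∧
      ‖DL2 F n K c₀ U₀ (toL2S F K c₀ N)‖ ≤ C₀ * q m ∧ ‖covLapSite F n K c₀ U₀ (toL2S F K c₀ N)‖ ≤ C₀ * q m)
    (hKT : ∀ l₁ : Site (F.P K) 0 → Matrix (Fin 2) (Fin 2) ℂ, toL2S F K c₀ l₁ ∈ NS F n K h c₀ cB U₀ → Z l₁ →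
      q (Kop l₁) ≤ δ * (‖toL2S F K c₀ l₁‖ + ‖DL2 F n K c₀ U₀ (toL2S F K c₀ l₁)‖))
    (hPoinc : ∀ l₁ : Site (F.P K) 0 → Matrix (Fin 2) (Fin 2) ℂ, toL2S F K c₀ l₁ ∈ NS F n K h c₀ cB U₀ → Z l₁ →
      ‖toL2S F K c₀ l₁‖ ^ 2 ≤ P₂ * ‖DL2 F n K c₀ U₀ (toL2S F K c₀ l₁)‖ ^ 2) :
    ∀ l₁ : Site (F.P K) 0 → Matrix (Fin 2) (Fin 2) ℂ, toL2S F K c₀ l₁ ∈ NS F n K h c₀ cB U₀ → Z l₁ →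
      ∃ (N' : Site (F.P K) 0 → Matrix (Fin 2) (Fin 2) ℂ) (w : PBond (F.P K) 0 → Matrix (Fin 2) (Fin 2) ℂ),
        (∀ b, M b (w b) = Gd N' b) ∧ T w = 0 ∧
        ‖DstarL2 F n K c₀ U₀ (toL2 F K c₀ w + ((eta F n K : ℝ) : ℂ) • DL2 F n K c₀ U₀ (toL2S F K c₀ N'))‖
          ≤ eta F n K * a' * (‖toL2S F K c₀ N'‖ + ‖DL2 F n K c₀ U₀ (toL2S F K c₀ N')‖) ∧
        ‖covLapSite F n K c₀ U₀ (toL2S F K c₀ N' - toL2S F K c₀ l₁)‖ ≤ C₀ * δ * (2 * P₂) * ‖covLapSite F n K c₀ U₀ (toL2S F K c₀ l₁)‖ ∧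
        ‖toL2S F K c₀ N' - toL2S F K c₀ l₁‖ ≤ C₀ * δ * (2 * P₂) * ‖covLapSite F n K c₀ U₀ (toL2S F K c₀ l₁)‖ ∧
        ‖DL2 F n K c₀ U₀ (toL2S F K c₀ N' - toL2S F K c₀ l₁)‖ ≤ C₀ * δ * (2 * P₂) * ‖covLapSite F n K c₀ U₀ (toL2S F K c₀ l₁)‖ := by
  intro l₁ hl₁ hZ₁
  obtain ⟨N, hKN, hN0, hN1, hN2⟩ := hQ4 (Kop l₁)
  have hK0 : Kop (l₁ - N) = 0 := by rw [hKsub, hKN, sub_self]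
  choose w hw using fun b => hMs b (Gd (l₁ - N) b)
  refine ⟨l₁ - N, w, hw, hT _ w hw hK0, hDstar _ w hw, ?_⟩
  -- the common size `C₀·q(𝓚 l₁) ≤ C₀·δ·(2P₂)·‖Δ^η l₁‖`
  set r : ℝ := ‖covLapSite F n K c₀ U₀ (toL2S F K c₀ l₁)‖ with hr
  obtain ⟨hD, h0⟩ := norms_le_of_poincareSq F U₀ h1 (toL2S F K c₀ l₁) (hPoinc l₁ hl₁ hZ₁)
  have hq : C₀ * q (Kop l₁) ≤ C₀ * δ * (2 * P₂) * r := by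
    calc C₀ * q (Kop l₁) ≤ C₀ * (δ * (‖toL2S F K c₀ l₁‖ + ‖DL2 F n K c₀ U₀ (toL2S F K c₀ l₁)‖)) := mul_le_mul_of_nonneg_left (hKT l₁ hl₁ hZ₁) hC₀
      _ ≤ C₀ * (δ * (P₂ * r + P₂ * r)) := by gcongr
      _ = C₀ * δ * (2 * P₂) * r := by ring
  have hdiff : toL2S F K c₀ (l₁ - N) - toL2S F K c₀ l₁ = -toL2S F K c₀ N := by rw [map_sub]; abel
  refine ⟨?_, ?_, ?_⟩
  · rw [hdiff, map_neg, norm_neg]; exact hN2.trans hq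
  · rw [hdiff, norm_neg]; exact hN0.trans hq
  · rw [hdiff, map_neg, norm_neg]; exact hN1.trans hq

/-! ## §4 The pairing test from the six rows -/

/-- ★★★ **THE (P2-core) PAIRING TEST OF ✓`hcore_of_pairing` FROM THE SIX DISPLAYED ROWS OF PLAN v2** (= ✓`htest_of_suppliersZ` ∘ (✓`hP_of_poincareZ`, ✓`hS_of_rowsZ`)): sector predicate
`Z` and coarse currency `(Y, q)` arbitrary; rows (Poincaré on `N_S ∩ Z`, `1 ≤ P₂`), (H-Z), (M onto), (T), (D*) with rate `a′ ≥ 0`, (Q4-H²) with `C₀ ≥ 0`, (T-small) with `δ ≥ 0`; L-only window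
`2a′(P₂ + C₀δ(2P₂)) + C₀δ(2P₂) < 1`.  Consumers: ✓`Prop7LandauTransversalityMargin.hcore_of_pairing` ∕ ✓`hSplitP2_of_pairing` and ✓`Prop7LandauTransversalityMargin.hcore_su2_of_pairing` ∕
✓`Prop7LandauTransversalityMarginSU2Chart.hSplitP2_su2_of_pairing`, by `exact`. [cite: Balaban1985BackgroundPropagators, (3.3) p.391, (3.20)–(3.23) p.394, (3.115) p.418;
Balaban1985Variational, (45) p.285, (82)–(83) p.290] -/
theorem htest_of_rows {h : n ≤ K} {cB : ℝ} (U₀ : GaugeField (F.P K) 0 (Matrix.specialUnitaryGroup (Fin 2) ℂ))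
    (Z : (Site (F.P K) 0 → Matrix (Fin 2) (Fin 2) ℂ) → Prop)
    {T : (PBond (F.P K) 0 → Matrix (Fin 2) (Fin 2) ℂ) →L[ℂ] (PBond (F.P n) 0 → Matrix (Fin 2) (Fin 2) ℂ)}
    (M : PBond (F.P K) 0 → (Matrix (Fin 2) (Fin 2) ℂ →L[ℂ] Matrix (Fin 2) (Fin 2) ℂ)) (hMs : ∀ b, Function.Surjective (M b))
    (Gd : (Site (F.P K) 0 → Matrix (Fin 2) (Fin 2) ℂ) →ₗ[ℂ] (PBond (F.P K) 0 → Matrix (Fin 2) (Fin 2) ℂ))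
    {Y : Type*} [AddCommGroup Y] (Kop : (Site (F.P K) 0 → Matrix (Fin 2) (Fin 2) ℂ) → Y) (q : Y → ℝ)
    (hKsub : ∀ a b : Site (F.P K) 0 → Matrix (Fin 2) (Fin 2) ℂ, Kop (a - b) = Kop a - Kop b)
    (hT : ∀ (N' : Site (F.P K) 0 → Matrix (Fin 2) (Fin 2) ℂ) (w : PBond (F.P K) 0 → Matrix (Fin 2) (Fin 2) ℂ),
      (∀ b, M b (w b) = Gd N' b) → Kop N' = 0 → T w = 0)
    {a' C₀ δ P₂ : ℝ} (ha' : 0 ≤ a') (hC₀ : 0 ≤ C₀) (hδ : 0 ≤ δ) (h1 : 1 ≤ P₂)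
    (hwin : 2 * a' * (P₂ + C₀ * δ * (2 * P₂)) + C₀ * δ * (2 * P₂) < 1)
    (hDstar : ∀ (N' : Site (F.P K) 0 → Matrix (Fin 2) (Fin 2) ℂ) (w : PBond (F.P K) 0 → Matrix (Fin 2) (Fin 2) ℂ), (∀ b, M b (w b) = Gd N' b) →
      ‖DstarL2 F n K c₀ U₀ (toL2 F K c₀ w + ((eta F n K : ℝ) : ℂ) • DL2 F n K c₀ U₀ (toL2S F K c₀ N'))‖
        ≤ eta F n K * a' * (‖toL2S F K c₀ N'‖ + ‖DL2 F n K c₀ U₀ (toL2S F K c₀ N')‖))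
    (hQ4 : ∀ m : Y, ∃ N : Site (F.P K) 0 → Matrix (Fin 2) (Fin 2) ℂ, Kop N = m ∧ ‖toL2S F K c₀ N‖ ≤ C₀ * q m ∧
      ‖DL2 F n K c₀ U₀ (toL2S F K c₀ N)‖ ≤ C₀ * q m ∧ ‖covLapSite F n K c₀ U₀ (toL2S F K c₀ N)‖ ≤ C₀ * q m)
    (hKT : ∀ l₁ : Site (F.P K) 0 → Matrix (Fin 2) (Fin 2) ℂ, toL2S F K c₀ l₁ ∈ NS F n K h c₀ cB U₀ → Z l₁ →
      q (Kop l₁) ≤ δ * (‖toL2S F K c₀ l₁‖ + ‖DL2 F n K c₀ U₀ (toL2S F K c₀ l₁)‖))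
    (hPoinc : ∀ l₁ : Site (F.P K) 0 → Matrix (Fin 2) (Fin 2) ℂ, toL2S F K c₀ l₁ ∈ NS F n K h c₀ cB U₀ → Z l₁ →
      ‖toL2S F K c₀ l₁‖ ^ 2 ≤ P₂ * ‖DL2 F n K c₀ U₀ (toL2S F K c₀ l₁)‖ ^ 2)
    (hHZ : ∀ l : Site (F.P K) 0 → Matrix (Fin 2) (Fin 2) ℂ, toL2S F K c₀ l ∈ NS F n K h c₀ cB U₀ →
      ∃ l₁ : Site (F.P K) 0 → Matrix (Fin 2) (Fin 2) ℂ, toL2S F K c₀ l₁ ∈ NS F n K h c₀ cB U₀ ∧ Z l₁ ∧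
        DL2 F n K c₀ U₀ (toL2S F K c₀ l₁) = DL2 F n K c₀ U₀ (toL2S F K c₀ l)) :
    ∀ l : Site (F.P K) 0 → Matrix (Fin 2) (Fin 2) ℂ, toL2S F K c₀ l ∈ NS F n K h c₀ cB U₀ →
      covLapSite F n K c₀ U₀ (toL2S F K c₀ l) ≠ 0 →
      ∃ (N' : Site (F.P K) 0 → Matrix (Fin 2) (Fin 2) ℂ) (w : PBond (F.P K) 0 → Matrix (Fin 2) (Fin 2) ℂ),
        (∀ b, M b (w b) = Gd N' b) ∧ T w = 0 ∧ ⟪toL2 F K c₀ w, DL2 F n K c₀ U₀ (covLapSite F n K c₀ U₀ (toL2S F K c₀ l))⟫_ℂ ≠ 0 :=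
  htest_of_suppliersZ F U₀ Z M Gd ha' hwin (hP_of_poincareZ F U₀ Z h1 hPoinc hHZ)
    (hS_of_rowsZ F U₀ Z M hMs Gd Kop q hKsub hT hC₀ hδ h1 hDstar hQ4 hKT hPoinc)

end Summit.QuantumFields.YangMills.Theorems.Prop7LandauTransversalityPairing

end
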